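import Summits.QuantumFields.YangMills.Theorems.UnitScaleTiltCoverSitesPush
import HarnessLib

/-!
# Route `UnitScaleTilt`, crux K1 «MinimiserStabilityRegPr» (stmt-QuantumFields-19200), EX face (the [B9] §3 kernel rows, measured between ITERATED BLOCKS
# `iterBlockOf (K−n)` of level-0 bonds), road (R2) «COVER DESCENT» — brick **THE COVER FIBRES ARE COMPATIBLE WITH BLOCKING**: the `j`-fold block map sends the
# level-0 fibre `π⁻¹ y` BIJECTIVELY onto the level-`j` fibre `π⁻¹ (Bʲ y)`, so a fibre sum of a function of `Bʲ ỹ` is a level-`j` fibre sum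

Cell `ym3-torus` (HUMAN RULING D-0037, YM ladder rung R3 — continuum SU(2) YM₃ on T³ is a RUNG: NOT d = 4, NOT infinite volume, NOT a mass gap, NOT the Clay
problem), width seat `ym3-torus-px4` gen 10.  THEOREMS ONLY (0 `def`, 0 `sorry`, default heartbeats); `--supports stmt-QuantumFields-19200 --as helper`; count-neutral.
Companion of `…CoverKernelFibreSum` (the fibre sum of `e^{−δ|x̃ − ỹ|₁}` at ONE level): the EX face's kernel rows (`h133 h88 h137kπ h137kΔ hCk h349`) weigh a level-0
point source `single y Z` by `e^{−δ·|B^{K−n} b′ − B^{K−n} y|₁}`, a distance between `(K−n)`-fold blocks; this file moves the level-0 fibre sum to level `K − n`, where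
`…CoverKernelFibreSum.sum_fibre_exp_neg_tdist_le'` applies verbatim.

WHAT IS PROVED (namespace `…Theorems.CoverFibreBlocks`; [folklore] `ZMod.val` ∕ `Nat.div` ∕ `Nat.mod` bookkeeping on `(ℤ∕Ñ)^d → (ℤ∕N)^d`):
* (canonical representatives `(Bʲ x)_μ = x_μ ∕ Lʲ` are the tree's ✓`B5Eq118OneStroke.val_iterBlockOf` ∕ ✓`Site.val_blockOf`, cited BY NAME — not restated.)
* §1 `iterBlockOf_mem_fibre` (`π ỹ = y ⇒ π (Bʲ ỹ) = Bʲ y`, = ✓`CoverSites.proj_iterBlockOf`), ★`iterBlockOf_injOn_fibre` (`Bʲ` is injective on each level-0 fibre: two lifts of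
  `y` agree `mod N₀`, and `Lʲ ∣ N₀` makes equal quotients by `Lʲ` force equal remainders), ★`image_iterBlockOf_fibre` (the image IS the level-`j` fibre of `Bʲ y` — both
  have `(L^{jc})^d` elements, ✓`CoverSites.card_fibre_site`).
* §2 ★★`sum_fibre_comp_iterBlockOf`: `Σ_{π ỹ = y} f (Bʲ ỹ) = Σ_{π z̃ = Bʲ y} f z̃` for every `f` into an additive commutative monoid (`j ≤ m + K`).
HONEST SCOPE: finite-torus bookkeeping; no analysis; nothing of the thirteen N06 rows, `hThm2S`, EX or the crux is claimed; NOT a claim about the rung or a mass gap.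

References: T. Bałaban, CMP **109** (1987) 249–301 [Balaban1987RG1] ((0.1)–(0.3) pp.251–252: the tori `T^{(i)}`, the blocks `B(y)` and their iterates); CMP **95** (1984)
17–40 [Balaban1984PropagatorsI] ((1.18) p.20: `B^k(y)`); CMP **99** (1985) 389–434 [Balaban1985BackgroundPropagators] ((3.42) p.397: kernels weighted by `e^{−δ₀|y−y′|}` between
block points).
-/

open scoped BigOperators

namespace Summit.QuantumFields.YangMills.Theorems.CoverFibreBlocks

open Literature.MathematicalPhysics.QuantumFieldTheory.Balaban1983to89
open B5Eq118OneStroke (iterBlockOf iterBlockOf_zero iterBlockOf_succ val_iterBlockOf)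
open Summit.QuantumFields.YangMills.Theorems.CoverSites

/-! ## §1 The `j`-fold block map on a level-0 fibre: into the level-`j` fibre, injective, onto -/

section Fibre

variable (P : Params) (jc : ℕ)

/-- `π ỹ = y ⇒ π (Bʲ ỹ) = Bʲ y` (✓`CoverSites.proj_iterBlockOf`). [cite: Balaban1987RG1, (0.3) p.252] -/
theorem iterBlockOf_mem_fibre {j : ℕ} (hj : j ≤ P.m + P.K) {y : Site P 0} {yt : Site (cover P jc) 0} (h : proj P jc 0 yt = y) :
    proj P jc j (iterBlockOf j yt) = iterBlockOf j y := by
  rw [proj_iterBlockOf P jc j hj, h]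

/-- ★ **`Bʲ` IS INJECTIVE ON EVERY LEVEL-0 FIBRE**: two lifts of the same site agree modulo `N₀ = 2L^{m+K}` coordinatewise; if their quotients by `Lʲ` agree too,
then — since `Lʲ ∣ N₀` — so do their remainders modulo `Lʲ`, hence the representatives themselves. [folklore] -/
theorem iterBlockOf_injOn_fibre {j : ℕ} (hj : j ≤ P.m + P.K) (y : Site P 0) :
    Set.InjOn (iterBlockOf (P := cover P jc) j) ↑(Finset.univ.filter fun yt : Site (cover P jc) 0 => proj P jc 0 yt = y) := by
  intro yt hyt yt' hyt' hB
  simp only [Finset.coe_filter, Finset.mem_univ, true_and, Set.mem_setOf_eq] at hyt hyt'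
  have hjc : j ≤ (cover P jc).m + (cover P jc).K := by show j ≤ P.m + jc + P.K; omega
  have hdvd : P.L ^ j ∣ P.sitesPerDir 0 := by
    unfold Params.sitesPerDir
    exact Dvd.dvd.mul_left (pow_dvd_pow P.L (by omega)) 2
  funext μ
  apply ZMod.val_injective
  -- same residue mod `N₀`
  have hmod : (yt μ).val % P.sitesPerDir 0 = (yt' μ).val % P.sitesPerDir 0 := by
    have h1 := val_proj P jc 0 yt μ
    have h2 := val_proj P jc 0 yt' μ
    rw [hyt] at h1
    rw [hyt'] at h2
    exact h1.symm.trans h2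
  -- same quotient by `Lʲ`
  have hdiv : (yt μ).val / P.L ^ j = (yt' μ).val / P.L ^ j := by
    have h1 : ((iterBlockOf j yt) μ).val = (yt μ).val / P.L ^ j := val_iterBlockOf j hjc yt μ
    have h2 : ((iterBlockOf j yt') μ).val = (yt' μ).val / P.L ^ j := val_iterBlockOf j hjc yt' μ
    rw [← h1, ← h2, hB]
  -- hence same remainder mod `Lʲ`, hence equal
  have hrem : (yt μ).val % P.L ^ j = (yt' μ).val % P.L ^ j := by
    rw [← Nat.mod_mod_of_dvd _ hdvd, hmod, Nat.mod_mod_of_dvd _ hdvd]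
  rw [← Nat.div_add_mod ((yt μ).val) (P.L ^ j), hdiv, hrem, Nat.div_add_mod]

/-- ★ **THE IMAGE OF A LEVEL-0 FIBRE UNDER `Bʲ` IS THE LEVEL-`j` FIBRE OF `Bʲ y`** (`j ≤ m + K`): it lies inside by `iterBlockOf_mem_fibre`, and both sets have `(L^{jc})^d`
elements (✓`CoverSites.card_fibre_site` at levels `0` and `j`; `Bʲ` injective on the fibre). [folklore] -/
theorem image_iterBlockOf_fibre {j : ℕ} (hj : j ≤ P.m + P.K) (y : Site P 0) :
    (Finset.univ.filter fun yt : Site (cover P jc) 0 => proj P jc 0 yt = y).image (iterBlockOf (P := cover P jc) j) =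
      Finset.univ.filter fun zt : Site (cover P jc) j => proj P jc j zt = iterBlockOf j y := by
  apply Finset.eq_of_subset_of_card_le
  · intro zt hzt
    simp only [Finset.mem_image, Finset.mem_filter, Finset.mem_univ, true_and] at hzt ⊢
    obtain ⟨yt, hyt, rfl⟩ := hzt
    exact iterBlockOf_mem_fibre P jc hj hyt
  · rw [Finset.card_image_of_injOn (iterBlockOf_injOn_fibre P jc hj y), card_fibre_site P jc j hj, card_fibre_site P jc 0 (Nat.zero_le _)]

end Fibre

/-! ## §2 ★★ Fibre sums are compatible with blocking -/

section Sums

variable (P : Params) (jc : ℕ) {M : Type*} [AddCommMonoid M]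

/-- ★★ **`Σ_{π ỹ = y} f (Bʲ ỹ) = Σ_{π z̃ = Bʲ y} f z̃`** (`j ≤ m + K`): a level-0 fibre sum of a function of the `j`-fold block is the level-`j` fibre sum — the form in which
`…CoverKernelFibreSum.sum_fibre_exp_neg_tdist_le'` (one level) meets the EX face's kernel rows (distances between `(K−n)`-fold blocks of level-0 bonds).
[cite: Balaban1985BackgroundPropagators, (3.42) p.397; Balaban1987RG1, (0.3) p.252] -/
theorem sum_fibre_comp_iterBlockOf {j : ℕ} (hj : j ≤ P.m + P.K) (y : Site P 0) (f : Site (cover P jc) j → M) :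
    ∑ yt ∈ Finset.univ.filter (fun yt : Site (cover P jc) 0 => proj P jc 0 yt = y), f (iterBlockOf j yt) =
      ∑ zt ∈ Finset.univ.filter (fun zt : Site (cover P jc) j => proj P jc j zt = iterBlockOf j y), f zt := by
  rw [← image_iterBlockOf_fibre P jc hj y, Finset.sum_image fun yt hyt yt' hyt' h => iterBlockOf_injOn_fibre P jc hj y hyt hyt' h]

/-- the bond-source form: summing `f (Bʲ b̃.src)` over the fibre of a level-0 BOND `b` (direction carried along by `projBond`) is the level-`j` site fibre sum at `Bʲ b.src`.
[cite: Balaban1985BackgroundPropagators, (3.42) p.397] -/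
theorem sum_bondFibre_comp_iterBlockOf [DecidableEq (PBond P 0)] {j : ℕ} (hj : j ≤ P.m + P.K) (b : PBond P 0) (f : Site (cover P jc) j → M) :
    ∑ bt ∈ Finset.univ.filter (fun bt : PBond (cover P jc) 0 => projBond P jc 0 bt = b), f (iterBlockOf j bt.src) =
      ∑ zt ∈ Finset.univ.filter (fun zt : Site (cover P jc) j => proj P jc j zt = iterBlockOf j b.src), f zt := by
  rw [← sum_fibre_comp_iterBlockOf P jc hj b.src f]
  refine Finset.sum_nbij' (fun bt => bt.src) (fun yt => ⟨yt, b.dir⟩) ?_ ?_ ?_ (fun yt _ => rfl) (fun bt _ => rfl)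
  · intro bt hbt
    simp only [Finset.mem_filter, Finset.mem_univ, true_and] at hbt ⊢
    rw [← hbt, projBond_src]
  · intro yt hyt
    simp only [Finset.mem_filter, Finset.mem_univ, true_and] at hyt ⊢
    cases b with
    | mk src dir => simp only at hyt; rw [projBond, hyt]
  · intro bt hbt
    simp only [Finset.mem_filter, Finset.mem_univ, true_and] at hbt
    cases bt with
    | mk src dir => rw [show dir = b.dir by rw [← hbt, projBond_dir]]

end Sums

end Summit.QuantumFields.YangMills.Theorems.CoverFibreBlocks
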